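import Mathlib

/-!
# V3U chart a, step C1: the root-chart action preserves the even subring `k[ρ², ρβ, β², x_c, …]`

(crux stmt-ResolutionOfSingularities-15640 `WildQuotients.WildQuotientResolution`, line `Sketch`,
sector `|G| = p`; programme V3U «toric exit» of `L/w45c/CHAIN.md` v5 §4 row stub-1, candidate C1
`chartA_map_adjoin_eq` of `L/w45c/W45cPlanSignaturesV5.lean` with the generator set `chartAGens`
(V5 §C, copied verbatim as a `def` — owner row stub-1, imported by stub-2's D3 / stub-4 / lead-1);
[OURS · L1 W4.5c] — NOT a statement of any manuscript; replaces the role of no printed item.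
Route-independent: `import Mathlib` only.)

On the root chart `U = k[x₀,…,x_{n-1}]` (re-using the variables: `ρ = X a`, `β = X b`) of
`Bl_{(x_a, x_b²)} 𝔸ⁿ`, the lifted Jordan block acts by `σ_U`: `ρ ↦ ρ`, `β ↦ β + ρ`,
`x_c ↦ x_c + ρβ`, passengers fixed. The chart-a ring is the EVEN subring
`k[ρ², ρβ, β², x_c, passengers] = Algebra.adjoin k (chartAGens k n a b)`, and
`chartA_map_adjoin_eq`: `σ_U` maps it ONTO itself (images `ρ²`, `ρβ + ρ²`, `β² + 2ρβ + ρ²`,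
`x_c + ρβ`; preimages `ρβ − ρ²`, `β² − 2ρβ + ρ²`, `x_c − ρβ + ρ²`) — every characteristic, no
hypothesis on the order of `σ_U`.
-/

-- single-problem summit: the doubled namespace component `ResolutionOfSingularities` is forced
set_option linter.dupNamespace false

noncomputable section

open MvPolynomial

namespace Summit.ResolutionOfSingularities.ResolutionOfSingularities.Theorems.WildQuotientResolution.ToricExit

/-- The chart-a generators inside the root chart `U = k[x]` (re-using the variables: `ρ = X a`,
`β = X b`): `x_a = ρ²`, `x_b = ρβ`, `r = β²`, and the other coordinates (V5 §C, verbatim).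
[OURS · L1 W4.5c] -/
def chartAGens (k : Type) [Field k] (n : ℕ) (a b : Fin n) : Set (MvPolynomial (Fin n) k) :=
  {X a ^ 2, X a * X b, X b ^ 2} ∪ ((fun i => X i) '' {i | i ≠ a ∧ i ≠ b})

variable (k : Type) [Field k] (n : ℕ) (a b : Fin n)

/-- `ρ² ∈ k[chartAGens]`. [folklore] -/
theorem sq_a_mem_adjoin : (X a ^ 2 : MvPolynomial (Fin n) k) ∈ Algebra.adjoin k (chartAGens k n a b) :=
  Algebra.subset_adjoin (Or.inl (by simp))

/-- `ρβ ∈ k[chartAGens]`. [folklore] -/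
theorem mul_ab_mem_adjoin :
    (X a * X b : MvPolynomial (Fin n) k) ∈ Algebra.adjoin k (chartAGens k n a b) :=
  Algebra.subset_adjoin (Or.inl (by simp))

/-- `β² ∈ k[chartAGens]`. [folklore] -/
theorem sq_b_mem_adjoin : (X b ^ 2 : MvPolynomial (Fin n) k) ∈ Algebra.adjoin k (chartAGens k n a b) :=
  Algebra.subset_adjoin (Or.inl (by simp))

/-- Passengers `xᵢ`, `i ≠ a, b`, lie in `k[chartAGens]`. [folklore] -/
theorem X_mem_adjoin_of_ne (i : Fin n) (hia : i ≠ a) (hib : i ≠ b) :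
    (X i : MvPolynomial (Fin n) k) ∈ Algebra.adjoin k (chartAGens k n a b) :=
  Algebra.subset_adjoin (Or.inr ⟨i, ⟨hia, hib⟩, rfl⟩)

/-- **C1 `chartA_map_adjoin_eq`** (V5 §C, signature verbatim): the root-chart action `σ_U`
(`ρ ↦ ρ`, `β ↦ β + ρ`, `x_c ↦ x_c + ρβ`, passengers fixed) maps the even subring
`k[ρ², ρβ, β², x_c, …]` onto itself. [OURS · L1 W4.5c] [folklore] -/
theorem chartA_map_adjoin_eq (k : Type) [Field k] (n : ℕ)
    (σU : MvPolynomial (Fin n) k ≃ₐ[k] MvPolynomial (Fin n) k) (a b c : Fin n)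
    (hab : a ≠ b) (hbc : b ≠ c) (hac : a ≠ c)
    (hb : σU (X b) = X b + X a) (hc : σU (X c) = X c + X a * X b)
    (hσ : ∀ i, i ≠ b → i ≠ c → σU (X i) = X i) :
    Subalgebra.map (σU : MvPolynomial (Fin n) k →ₐ[k] MvPolynomial (Fin n) k)
        (Algebra.adjoin k (chartAGens k n a b)) = Algebra.adjoin k (chartAGens k n a b) := by
  set S := Algebra.adjoin k (chartAGens k n a b) with hS
  have ha : σU (X a) = X a := hσ a hab hac
  have h2a := sq_a_mem_adjoin k n a b
  have hab' := mul_ab_mem_adjoin k n a b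
  have h2b := sq_b_mem_adjoin k n a b
  have hXc : (X c : MvPolynomial (Fin n) k) ∈ S := X_mem_adjoin_of_ne k n a b c hac.symm hbc.symm
  apply le_antisymm
  · -- `σ_U (S) ≤ S`: check on the generators
    rw [Subalgebra.map_le, hS, Algebra.adjoin_le_iff]
    rintro g hg
    rw [SetLike.mem_coe, Subalgebra.mem_comap]
    change σU g ∈ Algebra.adjoin k (chartAGens k n a b)
    rcases hg with hg | ⟨i, ⟨hia, hib⟩, rfl⟩
    · simp only [Set.mem_insert_iff, Set.mem_singleton_iff] at hg
      rcases hg with rfl | rfl | rfl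
      · rw [map_pow, ha]
        exact h2a
      · rw [map_mul, ha, hb, mul_add, ← sq]
        exact add_mem hab' h2a
      · have e : σU (X b ^ 2) = X b ^ 2 + (X a * X b + X a * X b) + X a ^ 2 := by
          rw [map_pow, hb]; ring
        rw [e]
        exact add_mem (add_mem h2b (add_mem hab' hab')) h2a
    · by_cases hic : i = c
      · subst hic
        rw [hc]
        exact add_mem hXc hab'
      · rw [hσ i hib hic]
        exact X_mem_adjoin_of_ne k n a b i hia hib
  · -- `S ≤ σ_U (S)`: explicit preimages
    rw [hS, Algebra.adjoin_le_iff]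
    rintro g hg
    rw [SetLike.mem_coe, Subalgebra.mem_map]
    rcases hg with hg | ⟨i, ⟨hia, hib⟩, rfl⟩
    · simp only [Set.mem_insert_iff, Set.mem_singleton_iff] at hg
      rcases hg with rfl | rfl | rfl
      · refine ⟨X a ^ 2, h2a, ?_⟩
        change σU (X a ^ 2) = X a ^ 2
        rw [map_pow, ha]
      · refine ⟨X a * X b - X a ^ 2, sub_mem hab' h2a, ?_⟩
        change σU (X a * X b - X a ^ 2) = X a * X b
        rw [map_sub, map_mul, map_pow, ha, hb]; ring
      · refine ⟨X b ^ 2 - (X a * X b + X a * X b) + X a ^ 2,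
          add_mem (sub_mem h2b (add_mem hab' hab')) h2a, ?_⟩
        change σU (X b ^ 2 - (X a * X b + X a * X b) + X a ^ 2) = X b ^ 2
        rw [map_add, map_sub, map_add, map_pow, map_mul, map_pow, hb, ha]; ring
    · by_cases hic : i = c
      · subst hic
        refine ⟨X i - X a * X b + X a ^ 2, add_mem (sub_mem hXc hab') h2a, ?_⟩
        change σU (X i - X a * X b + X a ^ 2) = X i
        rw [map_add, map_sub, map_mul, map_pow, hc, ha, hb]; ring
      · refine ⟨X i, X_mem_adjoin_of_ne k n a b i hia hib, ?_⟩
        change σU (X i) = X i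
        exact hσ i hib hic

end Summit.ResolutionOfSingularities.ResolutionOfSingularities.Theorems.WildQuotientResolution.ToricExit

end
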